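import Mathlib
import Summits.KontsevichZagierPeriods.Zeta5Search.ClassTypeCover
import Summits.KontsevichZagierPeriods.Zeta5Search.RVClassLawCover
import Summits.KontsevichZagierPeriods.Zeta5Search.SmallPrimeDominance
import HarnessLib

/-!
# ζ(5) search — CLASS TYPE COVERS II: from a type cover to THEOREM LB / the Lemma-D bonus / the double-drop bonus (p3 g6)

HONEST FRAMING: systematic search; no irrationality claim unless certified.  Cell `pub-zeta5`, prover seat p3, generation 6.

§4 (any `b`): a COVER of the residues `x < p` by finitely many level types (`Cover b p TY`: every class `IsType b p x T cen` for
some `(T, cen) ∈ TY`) turns the class hypotheses of the tree's class laws into DECIDABLE checks on the list `TY`: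
`checkLB ⇒ A + B ≤ casLB b p` (`casLB_ge_of_cover`, via `casLB_ge_or_noPole`), `checkJ ⇒ casLB + 1 ≤ v_p(Cas_j)`
(`lemmaD_of_cover`, via `lemmaDBonus_holds`), `checkB ⇒ casLB + 2 ≤ v_p(Cas_j)` (`doubleDrop_of_cover`, via
`doubleDropBonus_holds`), and the fallback `checkLBx ⇒ casLB` value when the minimal exponent is not realised
(`casLB_ge_of_cover_x`).  File III (`RecordRayLevels`) specialises to the record ray; a per-window file then only proves
the cover (machine-generated, `omega`) — see `RecordLetters*.lean`.  Valuations of rationals; nothing here bears on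
irrationality.
-/

open Finset

namespace Summit.KontsevichZagierPeriods.Zeta5Search.ClassTypeCover

open Summit.KontsevichZagierPeriods.Zeta5Search.ClusterValuation
open Summit.KontsevichZagierPeriods.Zeta5Search.CasoratianValuation (InPolytope shift casoratian)
open Summit.KontsevichZagierPeriods.Zeta5Search.WedgeDictionary (dOf)
/-! ## §4 Covers and the hypotheses of the class laws -/

/-- **Every residue `x < p` is a typed level class with a type from the list `TY`.** -/
def Cover (b : ℕ → ℤ) (p : ℕ) (TY : List (List ℤ × Bool)) : Prop :=
  ∀ x, x < p → ∃ tc ∈ TY, IsType b p x tc.1 tc.2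

/-- Check for THEOREM LB at `A + B`: `A ≤ ν` on every pole type, `B ≤ 3 + E` on every multipole type. -/
def checkLB (odd : Bool) (TY : List (List ℤ × Bool)) (A B : ℤ) : Bool :=
  TY.all fun tc => (decide (polesL tc.1 = 0) || decide (A ≤ nuL odd tc.1 tc.2)) &&
    (decide (polesL tc.1 < 2) || decide (B ≤ 3 + expL odd tc.1 tc.2))

/-- Check of the four class hypotheses of `LemmaDBonus` at `m` (minimality, singles, one live minimal type). -/
def checkJ (odd : Bool) (TY : List (List ℤ × Bool)) (m : ℤ) : Bool :=
  TY.all fun tc =>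
    (decide (polesL tc.1 < 2) || decide (m ≤ expL odd tc.1 tc.2)) &&
    (!decide (polesL tc.1 = 1) || (decide (m ≤ -3) && decide (m < nuL odd tc.1 tc.2))) &&
    (TY.all fun tc' =>
      !(decide (2 ≤ polesL tc.1) && decide (2 ≤ polesL tc'.1) && decide (expL odd tc.1 tc.2 = m) &&
          decide (expL odd tc'.1 tc'.2 = m) && !droppedL odd tc.1 tc.2 && !droppedL odd tc'.1 tc'.2) ||
        sameTypeL tc.1 tc.2 tc'.1 tc'.2)

/-- Check of the class hypotheses of `DoubleDropBonus` at `N` (deeper classes tame singles; level `−N` tame single or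
centre-free palindrome). -/
def checkB (odd : Bool) (TY : List (List ℤ × Bool)) (N : ℕ) : Bool :=
  TY.all fun tc =>
    (!decide (expL odd tc.1 tc.2 < -(N : ℤ)) || (decide (polesL tc.1 = 1) && tameL tc.1)) &&
    (!decide (expL odd tc.1 tc.2 = -(N : ℤ)) ||
      ((decide (polesL tc.1 = 1) && tameL tc.1) || (!tc.2 && decide (tc.1.reverse = tc.1))))

/-- Membership in `multipoleClasses`. -/
theorem mem_multipoleClasses_iff (b : ℕ → ℤ) (p x : ℕ) :
    x ∈ multipoleClasses b p ↔ x < p ∧ 2 ≤ classPoleCount b p x := by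
  simp [multipoleClasses]

/-- Membership in `deepClasses`. -/
theorem mem_deepClasses_iff (b : ℕ → ℤ) (p N x : ℕ) :
    x ∈ deepClasses b p N ↔ x < p ∧ classExp b p x = -(N : ℤ) := by
  simp [deepClasses]

variable {p : ℕ}

/-- Check for THEOREM LB at `A + B` OFF the multipole types of exponent `m` (for the case that no class realises `m`):
`A ≤ ν` on every other pole type, `B ≤ 3 + E` on every other multipole type. -/
def checkLBx (odd : Bool) (TY : List (List ℤ × Bool)) (m A B : ℤ) : Bool :=
  TY.all fun tc => (decide (2 ≤ polesL tc.1) && decide (expL odd tc.1 tc.2 = m)) ||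
    ((decide (polesL tc.1 = 0) || decide (A ≤ nuL odd tc.1 tc.2)) &&
      (decide (polesL tc.1 < 2) || decide (B ≤ 3 + expL odd tc.1 tc.2)))

/-- **THEOREM LB's value from a cover**: `A + B ≤ casLB b p`, or there is no pole class at all (`casLB = 0`). -/
theorem casLB_ge_of_cover [Fact p.Prime] {b : ℕ → ℤ} {TY : List (List ℤ × Bool)} (hcov : Cover b p TY) {A B : ℤ}
    (hchk : checkLB (decide (¬ (2 : ℤ) ∣ b 0)) TY A B = true) (hB1 : B ≤ 1) (hpd : (p : ℤ) ≤ dOf b) :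
    casLB b p = 0 ∨ A + B ≤ casLB b p := by
  rw [checkLB, List.all_eq_true] at hchk
  have hA : ∀ x, x < p → 1 ≤ classPoleCount b p x → A ≤ classNu b p x := by
    intro x hx h1
    obtain ⟨tc, htc, ht⟩ := hcov x hx
    have hc := hchk tc htc
    simp only [Bool.and_eq_true, Bool.or_eq_true, decide_eq_true_eq] at hc
    rw [ht.classPoleCount_eq] at h1
    rw [ht.classNu_eq]
    rcases hc.1 with h0 | hA
    · omega
    · exact hA
  have hB : ∀ x, x < p → 2 ≤ classPoleCount b p x → B ≤ 3 + classExp b p x := by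
    intro x hx h2
    obtain ⟨tc, htc, ht⟩ := hcov x hx
    have hc := hchk tc htc
    simp only [Bool.and_eq_true, Bool.or_eq_true, decide_eq_true_eq] at hc
    rw [ht.classPoleCount_eq] at h2
    rw [ht.classExp_eq]
    rcases hc.2 with h0 | hB
    · omega
    · exact hB
  rcases casLB_ge_or_noPole b p A B hA hB1 hB (fun h => absurd hpd (not_le.2 h)) with ⟨h0, -⟩ | h
  · exact Or.inl h0
  · exact Or.inr h

/-- **THEOREM LB's value from a cover when the exponent `m` is NOT realised by a multipole class**: `A + B ≤ casLB b p`
(check off the `m`-types), or there is no pole class at all. -/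
theorem casLB_ge_of_cover_x [Fact p.Prime] {b : ℕ → ℤ} {TY : List (List ℤ × Bool)} (hcov : Cover b p TY) {m A B : ℤ}
    (hchk : checkLBx (decide (¬ (2 : ℤ) ∣ b 0)) TY m A B = true) (hB1 : B ≤ 1) (hpd : (p : ℤ) ≤ dOf b)
    (hnreal : ¬ ∃ x, x < p ∧ 2 ≤ classPoleCount b p x ∧ classExp b p x = m) :
    casLB b p = 0 ∨ A + B ≤ casLB b p := by
  rw [checkLBx, List.all_eq_true] at hchk
  have hA : ∀ x, x < p → 1 ≤ classPoleCount b p x → A ≤ classNu b p x := by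
    intro x hx h1
    obtain ⟨tc, htc, ht⟩ := hcov x hx
    have hc := hchk tc htc
    simp only [Bool.and_eq_true, Bool.or_eq_true, decide_eq_true_eq] at hc
    rw [ht.classPoleCount_eq] at h1
    rw [ht.classNu_eq]
    rcases hc with ⟨h2, hE⟩ | ⟨h0 | hA, -⟩
    · exact absurd ⟨x, hx, by rw [ht.classPoleCount_eq]; exact h2, by rw [ht.classExp_eq]; exact hE⟩ hnreal
    · omega
    · exact hA
  have hB : ∀ x, x < p → 2 ≤ classPoleCount b p x → B ≤ 3 + classExp b p x := by
    intro x hx h2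
    obtain ⟨tc, htc, ht⟩ := hcov x hx
    have hc := hchk tc htc
    simp only [Bool.and_eq_true, Bool.or_eq_true, decide_eq_true_eq] at hc
    rw [ht.classPoleCount_eq] at h2
    rw [ht.classExp_eq]
    rcases hc with ⟨h2', hE⟩ | ⟨-, h0 | hB⟩
    · exact absurd ⟨x, hx, by rw [ht.classPoleCount_eq]; exact h2', by rw [ht.classExp_eq]; exact hE⟩ hnreal
    · omega
    · exact hB
  rcases casLB_ge_or_noPole b p A B hA hB1 hB (fun h => absurd hpd (not_le.2 h)) with ⟨h0, -⟩ | h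
  · exact Or.inl h0
  · exact Or.inr h

/-- **The LEMMA-D BONUS from a cover**: `casLB b p + 1 ≤ v_p(Cas_j(b))`. -/
theorem lemmaD_of_cover {b : ℕ → ℤ} {j : ℕ} (hb : InPolytope b) (hj1 : 1 ≤ j) (hj7 : j ≤ 7)
    (hb' : InPolytope (shift b j)) (hpr : p.Prime) (hp5 : 5 ≤ p) (hpb : (p : ℤ) ≤ b 0) (hpd : (p : ℤ) ≤ dOf b)
    (hwin : (b 0 + 2 : ℤ) < (p : ℤ) ^ 2) {TY : List (List ℤ × Bool)} (hcov : Cover b p TY) {m : ℤ}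
    (hchk : checkJ (decide (¬ (2 : ℤ) ∣ b 0)) TY m = true)
    (hreal : ∃ x, x < p ∧ 2 ≤ classPoleCount b p x ∧ classExp b p x = m) (hcas : casoratian b j ≠ 0) :
    casLB b p + 1 ≤ padicValRat p (casoratian b j) := by
  haveI : Fact p.Prime := ⟨hpr⟩
  rw [checkJ, List.all_eq_true] at hchk
  refine lemmaDBonus_holds b j p m hb hj1 hj7 hb' hpr hp5 hpb hpd hwin ?_ ?_ ?_ ?_ hcas
  · obtain ⟨x, hx, h2, hE⟩ := hreal
    exact ⟨x, (mem_multipoleClasses_iff b p x).2 ⟨hx, h2⟩, hE⟩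
  · intro x hxm
    obtain ⟨hx, h2⟩ := (mem_multipoleClasses_iff b p x).1 hxm
    obtain ⟨tc, htc, ht⟩ := hcov x hx
    have hc := (hchk tc htc)
    simp only [Bool.and_eq_true, Bool.or_eq_true, decide_eq_true_eq] at hc
    rw [ht.classPoleCount_eq] at h2
    rw [ht.classExp_eq]
    rcases hc.1.1 with h0 | hA
    · omega
    · exact hA
  · intro y hy h1
    obtain ⟨tc, htc, ht⟩ := hcov y hy
    have hc := (hchk tc htc)
    simp only [Bool.and_eq_true, Bool.or_eq_true, Bool.not_eq_true', decide_eq_false_iff_not,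
      decide_eq_true_eq] at hc
    rw [ht.classPoleCount_eq] at h1
    rw [ht.classNu_eq]
    rcases hc.1.2 with h0 | hA
    · exact absurd h1 h0
    · exact hA
  · intro x hxm y hym hEx hEy hdx hdy
    obtain ⟨hx, h2x⟩ := (mem_multipoleClasses_iff b p x).1 hxm
    obtain ⟨hy, h2y⟩ := (mem_multipoleClasses_iff b p y).1 hym
    obtain ⟨tc, htc, ht⟩ := hcov x hx
    obtain ⟨tc', htc', ht'⟩ := hcov y hy
    have h0 := hchk tc htc
    simp only [Bool.and_eq_true] at h0
    have hc := List.all_eq_true.1 h0.2 tc' htc'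
    rw [ht.classPoleCount_eq] at h2x
    rw [ht'.classPoleCount_eq] at h2y
    rw [ht.classExp_eq] at hEx
    rw [ht'.classExp_eq] at hEy
    rw [ht.droppedPair_eq] at hdx
    rw [ht'.droppedPair_eq] at hdy
    rw [ht.sameType_eq ht']
    simp only [Bool.or_eq_true, Bool.not_eq_true', Bool.and_eq_false_iff, decide_eq_false_iff_not, not_le,
      Bool.not_eq_false'] at hc
    rcases hc with hc | hc
    · exfalso
      rcases hc with ((((h | h) | h) | h) | h) | h
      · omega
      · omega
      · exact h hEx
      · exact h hEy
      · rw [hdx] at h; exact Bool.false_ne_true h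
      · rw [hdy] at h; exact Bool.false_ne_true h
    · exact hc

/-- **The DOUBLE-DROP BONUS from a cover**: `casLB b p + 2 ≤ v_p(Cas_j(b))`. -/
theorem doubleDrop_of_cover {b : ℕ → ℤ} {j : ℕ} (hb : InPolytope b) (hj1 : 1 ≤ j) (hj7 : j ≤ 7)
    (hb' : InPolytope (shift b j)) (hpr : p.Prime) (hp5 : 5 ≤ p) (hpb : (p : ℤ) ≤ b 0) (hpd : (p : ℤ) ≤ dOf b)
    (hwin : (b 0 + 2 : ℤ) < (p : ℤ) ^ 2) {TY : List (List ℤ × Bool)} (hcov : Cover b p TY) {N : ℕ} (hN : 3 ≤ N)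
    (hNe : Even N) (hchk : checkB (decide (¬ (2 : ℤ) ∣ b 0)) TY N = true)
    (hreal : ∃ x, x < p ∧ 2 ≤ classPoleCount b p x ∧ classExp b p x = -(N : ℤ)) (hcas : casoratian b j ≠ 0) :
    casLB b p + 2 ≤ padicValRat p (casoratian b j) := by
  haveI : Fact p.Prime := ⟨hpr⟩
  rw [checkB, List.all_eq_true] at hchk
  refine doubleDropBonus_holds b p j N hb hb' hj1 hj7 hpr hp5 hpb hpd hwin hN hNe ?_ ?_ ?_ hcas
  · intro x hx hE
    obtain ⟨tc, htc, ht⟩ := hcov x hx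
    have hc0 := hchk tc htc
    simp only [Bool.or_eq_true, Bool.not_eq_true', decide_eq_false_iff_not, Bool.and_eq_true,
      decide_eq_true_eq] at hc0
    have hc := hc0.1
    rw [ht.classExp_eq] at hE
    rw [ht.classPoleCount_eq, ht.tameSingle_eq]
    rcases hc with h | h
    · exact absurd hE h
    · exact h
  · obtain ⟨x, hx, h2, hE⟩ := hreal
    exact ⟨x, (mem_multipoleClasses_iff b p x).2 ⟨hx, h2⟩, hE⟩
  · intro x hxd
    obtain ⟨hx, hE⟩ := (mem_deepClasses_iff b p N x).1 hxd
    obtain ⟨tc, htc, ht⟩ := hcov x hx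
    have hc0 := hchk tc htc
    simp only [Bool.or_eq_true, Bool.not_eq_true', decide_eq_false_iff_not, Bool.and_eq_true,
      decide_eq_true_eq] at hc0
    have hc := hc0.2
    rw [ht.classExp_eq] at hE
    rcases hc with h | h | ⟨hc1, hc2⟩
    · exact absurd hE h
    · left; rw [ht.classPoleCount_eq, ht.tameSingle_eq]; exact h
    · right
      refine ⟨fun hcen => ?_, ht.pal_classSet hc2⟩
      have := ht.cen_iff.1 hcen
      rw [this] at hc1
      exact Bool.noConfusion hc1

end Summit.KontsevichZagierPeriods.Zeta5Search.ClassTypeCover
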